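import Summits.KontsevichZagierPeriods.KontsevichZagierPeriods.Theorems.TerasomaMultiplicationMultiplicationAccessibleCornerClosedGen
import Summits.KontsevichZagierPeriods.KontsevichZagierPeriods.Theorems.TerasomaMultiplicationMultiplicationAccessibleCornerGraphDerivGen
import Summits.KontsevichZagierPeriods.KontsevichZagierPeriods.Theorems.TerasomaMultiplicationMultiplicationAccessibleCornerGraphRepsGen
import Summits.KontsevichZagierPeriods.KontsevichZagierPeriods.Theorems.TerasomaMultiplicationMultiplicationAccessibleCornerThetaFactsGen
import Summits.KontsevichZagierPeriods.KontsevichZagierPeriods.Theorems.TerasomaMultiplicationMultiplicationAccessibleCornerThetaGeoGen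
import Summits.KontsevichZagierPeriods.KontsevichZagierPeriods.Theorems.TerasomaMultiplicationMultiplicationAccessibleCornerThetaDerivBoundGen
import Summits.KontsevichZagierPeriods.KontsevichZagierPeriods.Theorems.TerasomaMultiplicationMultiplicationAccessibleCornerYFactsGen
import Summits.KontsevichZagierPeriods.KontsevichZagierPeriods.Theorems.TerasomaMultiplicationMultiplicationAccessibleCornerYGeoGen
import Summits.KontsevichZagierPeriods.KontsevichZagierPeriods.Theorems.TerasomaMultiplicationMultiplicationAccessibleCornerYDerivBoundGen
import Literature.NumberTheory.Transcendental.KZLogCalculusProofs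
import Literature.NumberTheory.Transcendental.SemialgebraicLineDeriv

/-!
# `MultiplicationAccessible` (stmt-KontsevichZagierPeriods-12305), line `shifted-family-prime-sieve`:
the corner Stokes in dimension `p + 1`, all `p = n + 2` — the Newton–Leibniz moves and the Stokes core

The general-`p` Liouville rotation flow (lead c2's design, lead c3's assembly): the `n + 1` lateral
Newton–Leibniz moves `N_{θ_i} ∼ 0` (`cornerThetaGen`, glued from the landed `cornerThetaFactsGen`,
`cornerThetaDerivBoundGen`, `cornerThetaGeoGen` and the semialgebraicity of line derivatives), the
exceptional-face move `N_y ∼ −R` (`cornerYGen`, likewise from `cornerYFactsGen`, `cornerYDerivBoundGen`,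
`cornerYGeoGen`), and the Stokes bookkeeping: with the landed `v`-move (`cornerVGen`), closedness
(`cornerClosedGen`) and graph derivative (`cornerGraphDerivGen`) they give `[U, GD] ∼ R`
(`stokes_core_gen`): the graph density over the chart domain is equivalent to the Beta × Dirichlet
density of the exceptional face. References: Kontsevich–Zagier 2001 §1.2 rules (1), (3);
Basu–Pollack–Roy 2006 Prop. 3.22.
-/

noncomputable section

open MeasureTheory Set Real Finset
open scoped BigOperators Topology
open Literature.NumberTheory.Transcendental
open Literature.NumberTheory.Transcendental.KZ
open Literature.ModelTheory.ExponentialFields (IsSemialgebraic)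

namespace Summit.KontsevichZagierPeriods.TerasomaMultiplication.MultiplicationAccessible


/-- The open chart domain `W = U × (0,1)_v` is open. [folklore] -/
theorem CornerGen.isOpen_W (n : ℕ) : IsOpen {w : Fin (n + 3) → ℝ | (Fin.init w : Fin (n + 2) → ℝ) ∈ {u : Fin (n + 2) → ℝ | (∀ i : Fin (n + 1), 0 < u (Fin.castSucc i)) ∧ ∑ i : Fin (n + 1), u (Fin.castSucc i) < 1 ∧ 0 < u (Fin.last (n + 1)) ∧ u (Fin.last (n + 1)) * (1 - ∑ i : Fin (n + 1), u (Fin.castSucc i)) < 1 ∧ ∀ i : Fin (n + 1), u (Fin.last (n + 1)) * u (Fin.castSucc i) < 1} ∧ 0 < w (Fin.last (n + 2)) ∧ w (Fin.last (n + 2)) < 1} := by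
  have hinit : Continuous fun w : Fin (n + 3) → ℝ => (Fin.init w : Fin (n + 2) → ℝ) :=
    continuous_pi fun i => continuous_apply _
  have hl : Continuous fun w : Fin (n + 3) → ℝ => w (Fin.last (n + 2)) := continuous_apply _
  have h := ((CornerClosedG.isOpen_U.preimage hinit).inter (isOpen_lt (continuous_const (y := (0:ℝ))) hl)).inter
    (isOpen_lt hl (continuous_const (y := (1:ℝ))))
  convert h using 1
  ext w
  simp only [mem_setOf_eq, mem_inter_iff, Set.mem_preimage, and_assoc]

/-- The open chart domain `W = U × (0,1)_v` is `ℚ`-semialgebraic. [folklore] -/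
theorem CornerGen.isSemialgebraic_W (n : ℕ) : IsSemialgebraic ℚ {w : Fin (n + 3) → ℝ | (Fin.init w : Fin (n + 2) → ℝ) ∈ {u : Fin (n + 2) → ℝ | (∀ i : Fin (n + 1), 0 < u (Fin.castSucc i)) ∧ ∑ i : Fin (n + 1), u (Fin.castSucc i) < 1 ∧ 0 < u (Fin.last (n + 1)) ∧ u (Fin.last (n + 1)) * (1 - ∑ i : Fin (n + 1), u (Fin.castSucc i)) < 1 ∧ ∀ i : Fin (n + 1), u (Fin.last (n + 1)) * u (Fin.castSucc i) < 1} ∧ 0 < w (Fin.last (n + 2)) ∧ w (Fin.last (n + 2)) < 1} := by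
  have hA : IsSemialgebraic ℚ {w : Fin (n + 3) → ℝ | (Fin.init w : Fin (n + 2) → ℝ) ∈ {u : Fin (n + 2) → ℝ | (∀ i : Fin (n + 1), 0 < u (Fin.castSucc i)) ∧ ∑ i : Fin (n + 1), u (Fin.castSucc i) < 1 ∧ 0 < u (Fin.last (n + 1)) ∧ u (Fin.last (n + 1)) * (1 - ∑ i : Fin (n + 1), u (Fin.castSucc i)) < 1 ∧ ∀ i : Fin (n + 1), u (Fin.last (n + 1)) * u (Fin.castSucc i) < 1}} :=
    (CornerVGen.isSemialgebraic_U n).preimage_comp Fin.castSucc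
  have hB := Literature.ModelTheory.ExponentialFields.isSemialgebraic_setOf_eval_pos (k := ℚ) (R := ℝ)
    (MvPolynomial.X (Fin.last (n + 2)) : MvPolynomial (Fin (n + 3)) ℚ)
  have hC := Literature.ModelTheory.ExponentialFields.isSemialgebraic_setOf_eval_lt (k := ℚ) (R := ℝ)
    (MvPolynomial.X (Fin.last (n + 2)) : MvPolynomial (Fin (n + 3)) ℚ) 1
  convert (hA.inter hB).inter hC using 1
  ext w
  simp only [MvPolynomial.aeval_X, map_one, mem_setOf_eq, mem_inter_iff]
  tauto

/-- A slice derivative `HasDerivAt (a ↦ c (update w k a)) d (w k)` is the line derivative of `c` at `w`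
along `e_k`. [folklore] -/
theorem CornerGen.hasLineDerivAt_of_hasDerivAt_update {N : ℕ} {c : (Fin N → ℝ) → ℝ} {w : Fin N → ℝ}
    {k : Fin N} {d : ℝ} (h : HasDerivAt (fun a => c (Function.update w k a)) d (w k)) :
    HasLineDerivAt ℝ c d w (Pi.single k 1) := by
  have he : ∀ t : ℝ, w + t • (Pi.single k 1 : Fin N → ℝ) = Function.update w k (w k + t) := by
    intro t
    ext j
    by_cases hj : j = k
    · subst hj; simp
    · simp [hj]
  unfold HasLineDerivAt
  have h2 : HasDerivAt (fun t : ℝ => w k + t) 1 0 := by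
    simpa using (hasDerivAt_id (0:ℝ)).const_add (w k)
  have h1 : HasDerivAt (fun a => c (Function.update w k a)) d (w k + 0) := by rw [add_zero]; exact h
  have := h1.comp (0:ℝ) h2
  simp only [mul_one] at this
  exact this.congr_of_eventuallyEq (Filter.Eventually.of_forall fun t => by simp only [Function.comp, he])

/-- Slices of the open chart domain stay inside it near the base point (it is open). [folklore] -/
theorem CornerGen.eventually_line_mem {n : ℕ} {w : Fin (n + 3) → ℝ}
    (hw : w ∈ {w : Fin (n + 3) → ℝ | (Fin.init w : Fin (n + 2) → ℝ) ∈ {u : Fin (n + 2) → ℝ | (∀ i : Fin (n + 1), 0 < u (Fin.castSucc i)) ∧ ∑ i : Fin (n + 1), u (Fin.castSucc i) < 1 ∧ 0 < u (Fin.last (n + 1)) ∧ u (Fin.last (n + 1)) * (1 - ∑ i : Fin (n + 1), u (Fin.castSucc i)) < 1 ∧ ∀ i : Fin (n + 1), u (Fin.last (n + 1)) * u (Fin.castSucc i) < 1} ∧ 0 < w (Fin.last (n + 2)) ∧ w (Fin.last (n + 2)) < 1})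
    (k : Fin (n + 3)) :
    ∀ᶠ t in 𝓝 (0 : ℝ), w + t • (Pi.single k 1 : Fin (n + 3) → ℝ) ∈ {w : Fin (n + 3) → ℝ | (Fin.init w : Fin (n + 2) → ℝ) ∈ {u : Fin (n + 2) → ℝ | (∀ i : Fin (n + 1), 0 < u (Fin.castSucc i)) ∧ ∑ i : Fin (n + 1), u (Fin.castSucc i) < 1 ∧ 0 < u (Fin.last (n + 1)) ∧ u (Fin.last (n + 1)) * (1 - ∑ i : Fin (n + 1), u (Fin.castSucc i)) < 1 ∧ ∀ i : Fin (n + 1), u (Fin.last (n + 1)) * u (Fin.castSucc i) < 1} ∧ 0 < w (Fin.last (n + 2)) ∧ w (Fin.last (n + 2)) < 1} := by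
  have hc : Continuous fun t : ℝ => w + t • (Pi.single k 1 : Fin (n + 3) → ℝ) :=
    continuous_const.add (continuous_id.smul continuous_const)
  have h0 : w + (0 : ℝ) • (Pi.single k 1 : Fin (n + 3) → ℝ) = w := by simp
  exact hc.continuousAt.preimage_mem_nhds (by rw [h0]; exact (CornerGen.isOpen_W n).mem_nhds hw)

/-- **The lateral Newton–Leibniz moves, all `p`** (general sub-goal `cornerThetaGen` of the assembly), glued
from the registered stubs `cornerThetaFactsGen` (analysis of `Vθ i` on the closed band), `cornerThetaDerivBoundGen`
(bounded slice derivative), `IsSemialgebraicFunOn.of_hasLineDerivAt` (its semialgebraicity) and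
`cornerThetaGeoGen` (the rule-3 move). [cite: KontsevichZagier2001, §1.2 rule (3)] -/
theorem cornerThetaGen : ∀ (n : ℕ) (x s : ℚ), 2 ≤ x → 3 ≤ s → ∀ (Θ T : (Fin (n + 2) → ℝ) → Fin (n + 2) → ℝ) (Z S H K : (Fin (n + 2) → ℝ) → ℝ)
      (M : (Fin (n + 2) → ℝ) → Fin (n + 2) → ℝ) (P : (Fin (n + 3) → ℝ) → ℝ),
    (∀ u, Θ u 0 = 1 - ∑ i : Fin (n + 1), u (Fin.castSucc i)) → (∀ u (i : Fin (n + 1)), Θ u i.succ = u (Fin.castSucc i)) →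
    (∀ u k, T u k = 1 - u (Fin.last (n + 1)) * Θ u k) →
    (∀ u, Z u = (∏ k, T u k) ^ (1 / ((n:ℝ) + 2))) →
    (∀ u, S u = ∑ j ∈ Finset.range (n + 2), (-1:ℝ) ^ j * u (Fin.last (n + 1)) ^ j *
      ∑ A ∈ Finset.powersetCard (j + 1) (Finset.univ : Finset (Fin (n + 2))), ∏ k ∈ A, Θ u k) →
    (∀ u, H u = (∑ j ∈ Finset.range (n + 2), Z u ^ j) / S u) →
    (∀ u, K u = (∏ k, Θ u k) ^ ((s:ℝ) - 1)) →
    (∀ u k, M u k = (T u k) ^ (x:ℝ) * ∏ j : Fin (n + 1), (T u (k + j.succ)) ^ ((x:ℝ) + (((j:ℕ):ℝ) + 1) / ((n:ℝ) + 2) - 1)) →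
    (∀ w, P w = (w (Fin.last (n + 2))) ^ (((n:ℝ) + 2) * (x:ℝ) - 1) *
      (1 - w (Fin.last (n + 2)) * Z (Fin.init w)) ^ (((n:ℝ) + 2) * (s:ℝ) - 1) * H (Fin.init w) ^ (((n:ℝ) + 2) * (s:ℝ)) * K (Fin.init w)) →
    ∀ (Vθ : Fin (n + 1) → (Fin (n + 3) → ℝ) → ℝ), (∀ (i : Fin (n + 1)) w, Vθ i w = P w * (Fin.init w : Fin (n + 2) → ℝ) (Fin.castSucc i) *
      (∑ j, Θ (Fin.init w) j * (M (Fin.init w) i.succ - M (Fin.init w) j)) / (Fin.init w : Fin (n + 2) → ℝ) (Fin.last (n + 1))) →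
    ∀ i : Fin (n + 1), ∃ N : KZ.IntegralRep (n + 3), N.domain = {w : Fin (n + 3) → ℝ | (Fin.init w : Fin (n + 2) → ℝ) ∈ {u : Fin (n + 2) → ℝ | (∀ i : Fin (n + 1), 0 < u (Fin.castSucc i)) ∧ ∑ i : Fin (n + 1), u (Fin.castSucc i) < 1 ∧ 0 < u (Fin.last (n + 1)) ∧ u (Fin.last (n + 1)) * (1 - ∑ i : Fin (n + 1), u (Fin.castSucc i)) < 1 ∧ ∀ i : Fin (n + 1), u (Fin.last (n + 1)) * u (Fin.castSucc i) < 1} ∧ 0 < w (Fin.last (n + 2)) ∧ w (Fin.last (n + 2)) < 1} ∧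
      (∀ w ∈ N.domain, HasDerivAt (fun a => Vθ i (Function.update w (Fin.castSucc (Fin.castSucc i) : Fin (n + 3)) a)) (N.integrand w) (w (Fin.castSucc (Fin.castSucc i) : Fin (n + 3)))) ∧
      KZ.of N ∈ KZ.relations := by
  intro n x s hx hs Θ T Z S H K M P hΘ0 hΘs hT hZ hS hH hK hM hP Vθ hVθ i
  obtain ⟨hsa, hcont, hends⟩ := cornerThetaFactsGen n x s hx hs Θ T Z S H K M P hΘ0 hΘs hT hZ hS hH hK hM hP
    Vθ hVθ i _ rfl
  obtain ⟨d, ⟨C, hC⟩, hd⟩ := cornerThetaDerivBoundGen n x s hx hs Θ T Z S H K M P hΘ0 hΘs hT hZ hS hH hK hM hP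
    Vθ hVθ i
  have hWoWc : {w : Fin (n + 3) → ℝ | (Fin.init w : Fin (n + 2) → ℝ) ∈ {u : Fin (n + 2) → ℝ | (∀ i : Fin (n + 1), 0 < u (Fin.castSucc i)) ∧ ∑ i : Fin (n + 1), u (Fin.castSucc i) < 1 ∧ 0 < u (Fin.last (n + 1)) ∧ u (Fin.last (n + 1)) * (1 - ∑ i : Fin (n + 1), u (Fin.castSucc i)) < 1 ∧ ∀ i : Fin (n + 1), u (Fin.last (n + 1)) * u (Fin.castSucc i) < 1} ∧ 0 < w (Fin.last (n + 2)) ∧ w (Fin.last (n + 2)) < 1} ⊆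
      {w : Fin (n + 3) → ℝ | (∀ j : Fin (n + 1), j ≠ i → 0 < w (Fin.castSucc (Fin.castSucc j))) ∧ ∑ j ∈ Finset.univ.erase i, w (Fin.castSucc (Fin.castSucc j)) < 1 ∧
      0 < w (Fin.castSucc (Fin.last (n + 1))) ∧ w (Fin.castSucc (Fin.last (n + 1))) * (1 - ∑ j ∈ Finset.univ.erase i, w (Fin.castSucc (Fin.castSucc j))) < 2 ∧
      (∀ j : Fin (n + 1), j ≠ i → w (Fin.castSucc (Fin.last (n + 1))) * w (Fin.castSucc (Fin.castSucc j)) < 1) ∧ 0 < w (Fin.last (n + 2)) ∧ w (Fin.last (n + 2)) < 1 ∧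
      0 ≤ w (Fin.castSucc (Fin.castSucc i)) ∧ ∑ j : Fin (n + 1), w (Fin.castSucc (Fin.castSucc j)) ≤ 1 ∧ w (Fin.castSucc (Fin.last (n + 1))) * (1 - ∑ j : Fin (n + 1), w (Fin.castSucc (Fin.castSucc j))) ≤ 1 ∧
      w (Fin.castSucc (Fin.last (n + 1))) * w (Fin.castSucc (Fin.castSucc i)) ≤ 1} := by
    rintro w ⟨⟨hpos, hsum, hy, h0, hk⟩, hv0, hv1⟩
    have hpos' : ∀ j : Fin (n + 1), 0 < w (Fin.castSucc (Fin.castSucc j)) := hpos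
    have hsum' : ∑ j : Fin (n + 1), w (Fin.castSucc (Fin.castSucc j)) < 1 := hsum
    have hy' : 0 < w (Fin.castSucc (Fin.last (n + 1))) := hy
    have h0' : w (Fin.castSucc (Fin.last (n + 1))) * (1 - ∑ j : Fin (n + 1), w (Fin.castSucc (Fin.castSucc j))) < 1 := h0
    have hk' : ∀ j : Fin (n + 1), w (Fin.castSucc (Fin.last (n + 1))) * w (Fin.castSucc (Fin.castSucc j)) < 1 := hk
    have her : ∑ j ∈ Finset.univ.erase i, w (Fin.castSucc (Fin.castSucc j)) =
        ∑ j : Fin (n + 1), w (Fin.castSucc (Fin.castSucc j)) - w (Fin.castSucc (Fin.castSucc i)) := by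
      rw [← Finset.add_sum_erase Finset.univ (fun j => w (Fin.castSucc (Fin.castSucc j))) (Finset.mem_univ i)]
      ring
    refine ⟨fun j _ => hpos' j, ?_, hy', ?_, fun j _ => hk' j, hv0, hv1, (hpos' i).le, hsum'.le, h0'.le, (hk' i).le⟩
    · rw [her]; linarith [hpos' i]
    · rw [her]
      have := hk' i
      nlinarith
  have hdsa : IsSemialgebraicFunOn ℚ {w : Fin (n + 3) → ℝ | (Fin.init w : Fin (n + 2) → ℝ) ∈ {u : Fin (n + 2) → ℝ | (∀ i : Fin (n + 1), 0 < u (Fin.castSucc i)) ∧ ∑ i : Fin (n + 1), u (Fin.castSucc i) < 1 ∧ 0 < u (Fin.last (n + 1)) ∧ u (Fin.last (n + 1)) * (1 - ∑ i : Fin (n + 1), u (Fin.castSucc i)) < 1 ∧ ∀ i : Fin (n + 1), u (Fin.last (n + 1)) * u (Fin.castSucc i) < 1} ∧ 0 < w (Fin.last (n + 2)) ∧ w (Fin.last (n + 2)) < 1} d :=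
    IsSemialgebraicFunOn.of_hasLineDerivAt (Fin.castSucc (Fin.castSucc i)) hsa (CornerGen.isSemialgebraic_W n)
      hWoWc (fun w hw => (CornerGen.eventually_line_mem hw _).mono fun t ht => hWoWc ht)
      fun w hw => CornerGen.hasLineDerivAt_of_hasDerivAt_update (hd w hw)
  obtain ⟨N, hNd, hNi, hNrel⟩ := cornerThetaGeoGen n i (Vθ i) d C _ _ rfl rfl hsa hcont hends hdsa hC hd
  refine ⟨N, hNd, fun w hw => ?_, hNrel⟩
  rw [hNi hw]
  exact hd w (hNd ▸ hw)

/-- **The exceptional-face Newton–Leibniz move, all `p`** (general sub-goal `cornerYGen` of the assembly), glued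
from the registered stubs `cornerYFactsGen`, `cornerYDerivBoundGen`, `IsSemialgebraicFunOn.of_hasLineDerivAt` and
`cornerYGeoGen`. [cite: KontsevichZagier2001, §1.2 rule (3)] -/
theorem cornerYGen : ∀ (n : ℕ) (x s : ℚ), 2 ≤ x → 3 ≤ s → ∀ (Θ T : (Fin (n + 2) → ℝ) → Fin (n + 2) → ℝ) (Z S H K : (Fin (n + 2) → ℝ) → ℝ)
      (M : (Fin (n + 2) → ℝ) → Fin (n + 2) → ℝ) (P : (Fin (n + 3) → ℝ) → ℝ),
    (∀ u, Θ u 0 = 1 - ∑ i : Fin (n + 1), u (Fin.castSucc i)) → (∀ u (i : Fin (n + 1)), Θ u i.succ = u (Fin.castSucc i)) →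
    (∀ u k, T u k = 1 - u (Fin.last (n + 1)) * Θ u k) →
    (∀ u, Z u = (∏ k, T u k) ^ (1 / ((n:ℝ) + 2))) →
    (∀ u, S u = ∑ j ∈ Finset.range (n + 2), (-1:ℝ) ^ j * u (Fin.last (n + 1)) ^ j *
      ∑ A ∈ Finset.powersetCard (j + 1) (Finset.univ : Finset (Fin (n + 2))), ∏ k ∈ A, Θ u k) →
    (∀ u, H u = (∑ j ∈ Finset.range (n + 2), Z u ^ j) / S u) →
    (∀ u, K u = (∏ k, Θ u k) ^ ((s:ℝ) - 1)) →
    (∀ u k, M u k = (T u k) ^ (x:ℝ) * ∏ j : Fin (n + 1), (T u (k + j.succ)) ^ ((x:ℝ) + (((j:ℕ):ℝ) + 1) / ((n:ℝ) + 2) - 1)) →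
    (∀ w, P w = (w (Fin.last (n + 2))) ^ (((n:ℝ) + 2) * (x:ℝ) - 1) *
      (1 - w (Fin.last (n + 2)) * Z (Fin.init w)) ^ (((n:ℝ) + 2) * (s:ℝ) - 1) * H (Fin.init w) ^ (((n:ℝ) + 2) * (s:ℝ)) * K (Fin.init w)) →
    ∀ (Vy : (Fin (n + 3) → ℝ) → ℝ), (∀ w, Vy w = P w * ∑ k, Θ (Fin.init w) k * M (Fin.init w) k) →
    ∀ (R : KZ.IntegralRep (n + 2)), R.domain = {q : Fin (n + 2) → ℝ | (∀ i : Fin (n + 1), 0 < q (Fin.castSucc i)) ∧ ∑ i : Fin (n + 1), q (Fin.castSucc i) < 1 ∧ 0 < q (Fin.last (n + 1)) ∧ q (Fin.last (n + 1)) < 1} →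
    Set.EqOn R.integrand (fun q => (((n:ℝ) + 2) * (q (Fin.last (n + 1))) ^ (((n:ℝ) + 2) * (x:ℝ) - 1) * (1 - q (Fin.last (n + 1))) ^ (((n:ℝ) + 2) * (s:ℝ) - 1)) *
      (((n:ℝ) + 2) ^ (((n:ℝ) + 2) * (s:ℝ) - 1) * ((1 - ∑ i : Fin (n + 1), q (Fin.castSucc i)) * ∏ i : Fin (n + 1), q (Fin.castSucc i)) ^ ((s:ℝ) - 1))) R.domain →
    ∃ N : KZ.IntegralRep (n + 3), N.domain = {w : Fin (n + 3) → ℝ | (Fin.init w : Fin (n + 2) → ℝ) ∈ {u : Fin (n + 2) → ℝ | (∀ i : Fin (n + 1), 0 < u (Fin.castSucc i)) ∧ ∑ i : Fin (n + 1), u (Fin.castSucc i) < 1 ∧ 0 < u (Fin.last (n + 1)) ∧ u (Fin.last (n + 1)) * (1 - ∑ i : Fin (n + 1), u (Fin.castSucc i)) < 1 ∧ ∀ i : Fin (n + 1), u (Fin.last (n + 1)) * u (Fin.castSucc i) < 1} ∧ 0 < w (Fin.last (n + 2)) ∧ w (Fin.last (n + 2)) < 1} ∧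
      (∀ w ∈ N.domain, HasDerivAt (fun a => Vy (Function.update w (Fin.castSucc (Fin.last (n + 1)) : Fin (n + 3)) a)) (N.integrand w) (w (Fin.castSucc (Fin.last (n + 1)) : Fin (n + 3)))) ∧
      KZ.of N + KZ.of R ∈ KZ.relations := by
  intro n x s hx hs Θ T Z S H K M P hΘ0 hΘs hT hZ hS hH hK hM hP Vy hVy R hRd hRi
  obtain ⟨hsa, hcont, hends, hface⟩ := cornerYFactsGen n x s hx hs Θ T Z S H K M P hΘ0 hΘs hT hZ hS hH hK hM hP
    Vy hVy _ rfl
  obtain ⟨d, ⟨C, hC⟩, hd⟩ := cornerYDerivBoundGen n x s hx hs Θ T Z S H K M P hΘ0 hΘs hT hZ hS hH hK hM hP Vy hVy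
  have hWoWc : {w : Fin (n + 3) → ℝ | (Fin.init w : Fin (n + 2) → ℝ) ∈ {u : Fin (n + 2) → ℝ | (∀ i : Fin (n + 1), 0 < u (Fin.castSucc i)) ∧ ∑ i : Fin (n + 1), u (Fin.castSucc i) < 1 ∧ 0 < u (Fin.last (n + 1)) ∧ u (Fin.last (n + 1)) * (1 - ∑ i : Fin (n + 1), u (Fin.castSucc i)) < 1 ∧ ∀ i : Fin (n + 1), u (Fin.last (n + 1)) * u (Fin.castSucc i) < 1} ∧ 0 < w (Fin.last (n + 2)) ∧ w (Fin.last (n + 2)) < 1} ⊆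
      {w : Fin (n + 3) → ℝ | (∀ i : Fin (n + 1), 0 < w (Fin.castSucc (Fin.castSucc i))) ∧ ∑ i : Fin (n + 1), w (Fin.castSucc (Fin.castSucc i)) < 1 ∧ 0 < w (Fin.last (n + 2)) ∧ w (Fin.last (n + 2)) < 1 ∧
      0 ≤ w (Fin.castSucc (Fin.last (n + 1))) ∧ w (Fin.castSucc (Fin.last (n + 1))) * (1 - ∑ i : Fin (n + 1), w (Fin.castSucc (Fin.castSucc i))) ≤ 1 ∧ ∀ i : Fin (n + 1), w (Fin.castSucc (Fin.last (n + 1))) * w (Fin.castSucc (Fin.castSucc i)) ≤ 1} := by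
    rintro w ⟨⟨hpos, hsum, hy, h0, hk⟩, hv0, hv1⟩
    have hpos' : ∀ j : Fin (n + 1), 0 < w (Fin.castSucc (Fin.castSucc j)) := hpos
    have hsum' : ∑ j : Fin (n + 1), w (Fin.castSucc (Fin.castSucc j)) < 1 := hsum
    have hy' : 0 < w (Fin.castSucc (Fin.last (n + 1))) := hy
    have h0' : w (Fin.castSucc (Fin.last (n + 1))) * (1 - ∑ j : Fin (n + 1), w (Fin.castSucc (Fin.castSucc j))) < 1 := h0
    have hk' : ∀ j : Fin (n + 1), w (Fin.castSucc (Fin.last (n + 1))) * w (Fin.castSucc (Fin.castSucc j)) < 1 := hk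
    exact ⟨hpos', hsum', hv0, hv1, hy'.le, h0'.le, fun j => (hk' j).le⟩
  have hdsa : IsSemialgebraicFunOn ℚ {w : Fin (n + 3) → ℝ | (Fin.init w : Fin (n + 2) → ℝ) ∈ {u : Fin (n + 2) → ℝ | (∀ i : Fin (n + 1), 0 < u (Fin.castSucc i)) ∧ ∑ i : Fin (n + 1), u (Fin.castSucc i) < 1 ∧ 0 < u (Fin.last (n + 1)) ∧ u (Fin.last (n + 1)) * (1 - ∑ i : Fin (n + 1), u (Fin.castSucc i)) < 1 ∧ ∀ i : Fin (n + 1), u (Fin.last (n + 1)) * u (Fin.castSucc i) < 1} ∧ 0 < w (Fin.last (n + 2)) ∧ w (Fin.last (n + 2)) < 1} d :=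
    IsSemialgebraicFunOn.of_hasLineDerivAt (Fin.castSucc (Fin.last (n + 1))) hsa (CornerGen.isSemialgebraic_W n)
      hWoWc (fun w hw => (CornerGen.eventually_line_mem hw _).mono fun t ht => hWoWc ht)
      fun w hw => CornerGen.hasLineDerivAt_of_hasDerivAt_update (hd w hw)
  obtain ⟨N, hNd, hNi, hNrel⟩ :=
    cornerYGeoGen n x s (Vy) d C _ _ rfl rfl hsa hcont hends hface hdsa hC hd R hRd hRi
  refine ⟨N, hNd, fun w hw => ?_, hNrel⟩
  rw [hNi hw]
  exact hd w (hNd ▸ hw)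


namespace CornerGen

variable {d : ℕ}

/-- Pointwise sum of two representations on a common domain, with the additivity relation.
[cite: KontsevichZagier2001, §1.2 rule (1)] -/
theorem exists_add_rel (A B : IntegralRep d) (h : B.domain = A.domain) :
    ∃ T : IntegralRep d, T.domain = A.domain ∧ (T.integrand = fun z => A.integrand z + B.integrand z) ∧
      of T - of A - of B ∈ relations := by
  have hB : IsSemialgebraicFunOn ℚ A.domain B.integrand := h ▸ B.isSemialgebraicFunOn_integrand
  have hBi : IntegrableOn B.integrand A.domain := h ▸ B.integrableOn
  let T : IntegralRep d := ⟨A.domain, fun z => A.integrand z + B.integrand z, A.isSemialgebraic_domain,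
    IsSemialgebraicFunOn.add_holds A.isSemialgebraicFunOn_integrand hB, A.integrableOn.add hBi⟩
  refine ⟨T, rfl, rfl, integrandAddRel_subset_relations ⟨d, T, A, B, rfl, h, fun z _ => ?_, rfl⟩⟩
  simp [T]

/-- Finite pointwise sums of representations on a common domain exist and differ from the formal sum
by a relation. [cite: KontsevichZagier2001, §1.2 rule (1)] -/
theorem exists_sum_rel (A : IntegralRep d) : ∀ (k : ℕ) (N : Fin k → IntegralRep d), (∀ i, (N i).domain = A.domain) →
    ∃ T : IntegralRep d, T.domain = A.domain ∧ (T.integrand = fun z => ∑ i, (N i).integrand z) ∧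
      of T - ∑ i, of (N i) ∈ relations := by
  intro k
  induction k with
  | zero =>
    intro N _
    let T : IntegralRep d := ⟨A.domain, fun _ => 0, A.isSemialgebraic_domain,
      by simpa using isSemialgebraicFunOn_ratCast A.isSemialgebraic_domain 0, integrableOn_zero⟩
    refine ⟨T, rfl, ?_, ?_⟩
    · funext z; simp [T]
    · simp only [Finset.univ_eq_empty, Finset.sum_empty, sub_zero]
      exact of_mem_relations_of_eqOn_zero T fun z _ => rfl
  | succ k ih =>
    intro N hN
    obtain ⟨T, hTd, hTi, hTrel⟩ := ih (fun i => N i.castSucc) fun i => hN i.castSucc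
    obtain ⟨T', hT'd, hT'i, hT'rel⟩ := exists_add_rel T (N (Fin.last k)) ((hN _).trans hTd.symm)
    refine ⟨T', hT'd.trans hTd, ?_, ?_⟩
    · rw [hT'i]; funext z; rw [Fin.sum_univ_castSucc, hTi]
    · rw [Fin.sum_univ_castSucc]
      have : of T' - (∑ i : Fin k, of (N i.castSucc) + of (N (Fin.last k))) =
          (of T' - of T - of (N (Fin.last k))) + (of T - ∑ i : Fin k, of (N i.castSucc)) := by abel
      rw [this]
      exact relations.add_mem hT'rel hTrel

/-- **Stokes bookkeeping** (general): representations `N_i`, `A`, `B` on a common domain whose integrands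
satisfy `Σ_i N_i + A + B ≡ 0` give `Σ_i [N_i] + [A] + [B] ∈ relations`. [cite: KontsevichZagier2001, §1.2 rule (1)] -/
theorem of_sum_mem {k : ℕ} (N : Fin k → IntegralRep d) (A B : IntegralRep d)
    (hN : ∀ i, (N i).domain = A.domain) (hB : B.domain = A.domain)
    (h0 : ∀ z ∈ A.domain, ∑ i, (N i).integrand z + A.integrand z + B.integrand z = 0) :
    ∑ i, of (N i) + of A + of B ∈ relations := by
  obtain ⟨T, hTd, hTi, hTrel⟩ := exists_sum_rel A k N hN
  obtain ⟨T₂, hT₂d, hT₂i, b⟩ := exists_add_rel T A hTd.symm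
  obtain ⟨T₃, hT₃d, hT₃i, c⟩ := exists_add_rel T₂ B (hB.trans (hT₂d.trans hTd).symm)
  have hz : of T₃ ∈ relations := by
    refine of_mem_relations_of_eqOn_zero T₃ fun z hz => ?_
    rw [hT₃d, hT₂d, hTd] at hz
    simp only [hT₃i, hT₂i, hTi, Pi.zero_apply]
    exact h0 z hz
  have : ∑ i, of (N i) + of A + of B = -(of T - ∑ i, of (N i)) - (of T₂ - of T - of A) -
      (of T₃ - of T₂ - of B) + of T₃ := by abel
  rw [this]
  exact relations.add_mem (relations.sub_mem (relations.sub_mem (relations.neg_mem hTrel) b) c) hz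

end CornerGen

/-- **The Stokes core in dimension `p = n + 2`** (abstract atoms): closedness + the `n + 3` Newton–Leibniz
moves give `[U, GD] ∼ R` (graph density versus exceptional face). [cite: KontsevichZagier2001, §1.2] -/
theorem stokes_core_gen : ∀ (n : ℕ) (x s : ℚ), 2 ≤ x → 3 ≤ s → ∀ (Θ T : (Fin (n + 2) → ℝ) → Fin (n + 2) → ℝ) (Z S H K : (Fin (n + 2) → ℝ) → ℝ)
      (M : (Fin (n + 2) → ℝ) → Fin (n + 2) → ℝ) (P : (Fin (n + 3) → ℝ) → ℝ),
    (∀ u, Θ u 0 = 1 - ∑ i : Fin (n + 1), u (Fin.castSucc i)) → (∀ u (i : Fin (n + 1)), Θ u i.succ = u (Fin.castSucc i)) →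
    (∀ u k, T u k = 1 - u (Fin.last (n + 1)) * Θ u k) →
    (∀ u, Z u = (∏ k, T u k) ^ (1 / ((n:ℝ) + 2))) →
    (∀ u, S u = ∑ j ∈ Finset.range (n + 2), (-1:ℝ) ^ j * u (Fin.last (n + 1)) ^ j *
      ∑ A ∈ Finset.powersetCard (j + 1) (Finset.univ : Finset (Fin (n + 2))), ∏ k ∈ A, Θ u k) →
    (∀ u, H u = (∑ j ∈ Finset.range (n + 2), Z u ^ j) / S u) →
    (∀ u, K u = (∏ k, Θ u k) ^ ((s:ℝ) - 1)) →
    (∀ u k, M u k = (T u k) ^ (x:ℝ) * ∏ j : Fin (n + 1), (T u (k + j.succ)) ^ ((x:ℝ) + (((j:ℕ):ℝ) + 1) / ((n:ℝ) + 2) - 1)) →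
    (∀ w, P w = (w (Fin.last (n + 2))) ^ (((n:ℝ) + 2) * (x:ℝ) - 1) *
      (1 - w (Fin.last (n + 2)) * Z (Fin.init w)) ^ (((n:ℝ) + 2) * (s:ℝ) - 1) * H (Fin.init w) ^ (((n:ℝ) + 2) * (s:ℝ)) * K (Fin.init w)) →
    ∀ (G : (Fin (n + 2) → ℝ) → ℝ), (∀ t : Fin (n + 2) → ℝ, G t = (∑ j : Fin (n + 2), (∏ i ∈ Finset.univ.filter (fun i : Fin (n + 2) => i < j), t i) /
        ((∏ k, t k) ^ (1 / ((n:ℝ) + 2))) ^ (j:ℕ)) / ((n:ℝ) + 2) *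
      ∏ k : Fin (n + 2), (t k) ^ ((x:ℝ) + ((k:ℕ):ℝ) / ((n:ℝ) + 2) - 1) * (1 - t k) ^ ((s:ℝ) - 1)) →
    ∀ (C : ℝ), (∀ u ∈ {u : Fin (n + 2) → ℝ | (∀ i : Fin (n + 1), 0 < u (Fin.castSucc i)) ∧ ∑ i : Fin (n + 1), u (Fin.castSucc i) < 1 ∧ 0 < u (Fin.last (n + 1)) ∧ u (Fin.last (n + 1)) * (1 - ∑ i : Fin (n + 1), u (Fin.castSucc i)) < 1 ∧ ∀ i : Fin (n + 1), u (Fin.last (n + 1)) * u (Fin.castSucc i) < 1}, |G (T u) * (u (Fin.last (n + 1))) ^ (n + 1)| ≤ C * (1 - Z u) ^ (((n:ℝ) + 2) * (s:ℝ) - 1)) →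
    ∀ (rU : IntegralRep (n + 2)), rU.domain = {u : Fin (n + 2) → ℝ | (∀ i : Fin (n + 1), 0 < u (Fin.castSucc i)) ∧ ∑ i : Fin (n + 1), u (Fin.castSucc i) < 1 ∧ 0 < u (Fin.last (n + 1)) ∧ u (Fin.last (n + 1)) * (1 - ∑ i : Fin (n + 1), u (Fin.castSucc i)) < 1 ∧ ∀ i : Fin (n + 1), u (Fin.last (n + 1)) * u (Fin.castSucc i) < 1} →
    (rU.integrand = fun u => G (T u) * (u (Fin.last (n + 1))) ^ (n + 1)) →
    ∀ (R : IntegralRep (n + 2)), R.domain = {q : Fin (n + 2) → ℝ | (∀ i : Fin (n + 1), 0 < q (Fin.castSucc i)) ∧ ∑ i : Fin (n + 1), q (Fin.castSucc i) < 1 ∧ 0 < q (Fin.last (n + 1)) ∧ q (Fin.last (n + 1)) < 1} →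
    Set.EqOn R.integrand (fun q => (((n:ℝ) + 2) * (q (Fin.last (n + 1))) ^ (((n:ℝ) + 2) * (x:ℝ) - 1) * (1 - q (Fin.last (n + 1))) ^ (((n:ℝ) + 2) * (s:ℝ) - 1)) *
      (((n:ℝ) + 2) ^ (((n:ℝ) + 2) * (s:ℝ) - 1) * ((1 - ∑ i : Fin (n + 1), q (Fin.castSucc i)) * ∏ i : Fin (n + 1), q (Fin.castSucc i)) ^ ((s:ℝ) - 1))) R.domain →
    Equivalent rU R := by
  intro n x s hx hs Θ T Z S H K M P hΘ0 hΘs hT hZ hS hH hK hM hP G hG C hC rU hrUd hrUi R hRd hRi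
  have hx1 : (1:ℚ) ≤ x := by linarith
  have hs1 : (1:ℚ) ≤ s := by linarith
  -- the components (as lambdas over the abstract atoms)
  set Vθ : Fin (n + 1) → (Fin (n + 3) → ℝ) → ℝ := fun i w => P w * (Fin.init w : Fin (n + 2) → ℝ) (Fin.castSucc i) *
      (∑ j, Θ (Fin.init w) j * (M (Fin.init w) i.succ - M (Fin.init w) j)) /
      (Fin.init w : Fin (n + 2) → ℝ) (Fin.last (n + 1)) with hVθ
  set Vy : (Fin (n + 3) → ℝ) → ℝ := fun w => P w * ∑ k, Θ (Fin.init w) k * M (Fin.init w) k with hVy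
  set Vv : (Fin (n + 3) → ℝ) → ℝ := fun w => -(1 / ((n:ℝ) + 2) * (w (Fin.last (n + 2))) ^ (((n:ℝ) + 2) * (x:ℝ)) *
      (1 - w (Fin.last (n + 2)) * Z (Fin.init w)) ^ (((n:ℝ) + 2) * (s:ℝ) - 1) * H (Fin.init w) ^ (((n:ℝ) + 2) * (s:ℝ) - 1) *
      K (Fin.init w) * ∑ k, M (Fin.init w) k / T (Fin.init w) k) with hVv
  -- the lateral moves, the face move, the v-move
  have hθN := cornerThetaGen n x s hx hs Θ T Z S H K M P hΘ0 hΘs hT hZ hS hH hK hM hP Vθ (fun _ _ => rfl)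
  choose Nθ hNθd hNθder hNθrel using hθN
  obtain ⟨Ny, hNyd, hNyder, hNyrel⟩ :=
    cornerYGen n x s hx hs Θ T Z S H K M P hΘ0 hΘs hT hZ hS hH hK hM hP Vy (fun _ => rfl) R hRd hRi
  obtain ⟨Nv, hNvd, hNvi, hNveq⟩ := cornerVGen n x s hx1 hs1 Θ T Z (fun u => G (T u) * (u (Fin.last (n + 1))) ^ (n + 1)) C
    hΘ0 hΘs hT hZ hC rU hrUd (by rw [hrUi]; exact fun _ _ => rfl)
  -- closedness on `W`
  have hsum : ∀ w ∈ Ny.domain, ∑ i, (Nθ i).integrand w + Ny.integrand w + Nv.integrand w = 0 := by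
    intro w hw
    have hw' : w ∈ {w : Fin (n + 3) → ℝ | (Fin.init w : Fin (n + 2) → ℝ) ∈ {u : Fin (n + 2) → ℝ | (∀ i : Fin (n + 1), 0 < u (Fin.castSucc i)) ∧ ∑ i : Fin (n + 1), u (Fin.castSucc i) < 1 ∧ 0 < u (Fin.last (n + 1)) ∧ u (Fin.last (n + 1)) * (1 - ∑ i : Fin (n + 1), u (Fin.castSucc i)) < 1 ∧ ∀ i : Fin (n + 1), u (Fin.last (n + 1)) * u (Fin.castSucc i) < 1} ∧ 0 < w (Fin.last (n + 2)) ∧ w (Fin.last (n + 2)) < 1} := by rw [hNyd] at hw; exact hw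
    have hθ : ∀ i, HasDerivAt (fun a => Vθ i (Function.update w (Fin.castSucc (Fin.castSucc i) : Fin (n + 3)) a))
        ((Nθ i).integrand w) (w (Fin.castSucc (Fin.castSucc i) : Fin (n + 3))) :=
      fun i => hNθder i w (by rw [hNθd]; exact hw')
    have hy := hNyder w hw
    have hv : HasDerivAt (fun a => Vv (Function.update w (Fin.last (n + 2)) a)) (-(Nv.integrand w))
        (w (Fin.last (n + 2))) := by
      have hd := cornerGraphDerivGen n x s hx hs Θ T Z S H K M P hΘ0 hΘs hT hZ hS hH hK hM hP G hG Vv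
        (fun _ => rfl) w hw'
      convert hd using 2
      rw [hNvi]
    have hc := cornerClosedGen n x s hx hs Θ T Z S H K M P hΘ0 hΘs hT hZ hS hH hK hM hP Vθ Vy Vv
      (fun _ _ => rfl) (fun _ => rfl) (fun _ => rfl) w hw' _ _ _ hθ hy hv
    linarith
  have key := CornerGen.of_sum_mem Nθ Ny Nv (fun i => (hNθd i).trans hNyd.symm) (hNvd.trans hNyd.symm) hsum
  have hθrel : ∑ i, of (Nθ i) ∈ relations := sum_mem fun i _ => hNθrel i
  show of rU - of R ∈ relations
  have : of rU - of R = (∑ i, of (Nθ i) + of Ny + of Nv) - ∑ i, of (Nθ i) - (of Ny + of R) - (of Nv - of rU) := by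
    abel
  rw [this]
  exact relations.sub_mem (relations.sub_mem (relations.sub_mem key hθrel) hNyrel) hNveq

end Summit.KontsevichZagierPeriods.TerasomaMultiplication.MultiplicationAccessible
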